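import Summits.AtomisticToContinuum.Crystallization.Theorems.HullExactificationCascadeExactHcpLocalTheoremHexagon

/-!
# Route HullExactificationCascade — item `ExactHcpLocalTheorem` (G), helper 5: bond rigidity

Helper file 5 for `stmt-AtomisticToContinuum-12093`.  **Bond rigidity along the in-layer bond `u`**
(`image_cluster_eq_of_bond`): if the image cluster `A '' N` agrees near `−u` with the translate
`N − u` (the exactness carried along a bond), then `A '' N = N`.  The preimage `q = A⁻¹(−u)` is a
cluster site; it is not a cap site (`bond_not_cap`: the two bonded pairs `{u, v}`, `{p − u, p − v}`
among the neighbours of the cap `p` would both be mapped onto pairs containing `v − u`), so it is a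
hexagon site; after a symmetry `A` fixes `u`, then `−v` (`bond_fix_neg_v`, two more distance
tables), hence `A ∈ {1, σ_h}`.  This is the one place where the off-ideal envelope enters
(`4h² ≠ 3a²`); at the ideal ratio the same case analysis goes through. [folklore]
-/

noncomputable section

namespace Summit.AtomisticToContinuum.Crystallization.Theorems.ExactHcpLocal

open Literature.MathematicalPhysics.StatisticalMechanics

variable {a h : ℝ}

/-! ## Bond file: bond rigidity along the in-layer bond `u` -/

section Bond

open RealInnerProductSpace Literature.Geometry.DiscreteGeometry

/-- **The bond preimage is not a cap site.** In the situation of `window_of_bond`, after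
normalising by a symmetry of the cluster, suppose the cap site `p = w + h e₃` is mapped to `−u`
and all cluster sites near `p` are mapped to window sites.  The four cluster neighbours
`u, v, p − u, p − v` of `p` form two pairs at distance `a`, mapped to two disjoint pairs of window
sites (other than `0, −u`) at distance `a` — but every such pair contains `v − u`. [folklore] -/
theorem bond_not_cap (ha : 0 < a) (hh : 0 < h) (hh1 : 64 / 100 * a ^ 2 < h ^ 2)
    (hh2 : h ^ 2 < 69 / 100 * a ^ 2)
    (A : EuclideanSpace ℝ (Fin 3) ≃ₗᵢ[ℝ] EuclideanSpace ℝ (Fin 3))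
    (hAp : A (barlowPos a h alternatingHagg 1 0 0) = -barlowPos a h alternatingHagg 0 1 0)
    (hwin : ∀ x ∈ {p : EuclideanSpace ℝ (Fin 3) | p ∈ hcpStacking a h ∧ ‖p‖ < 13 / 10 * a},
      ‖x - barlowPos a h alternatingHagg 1 0 0‖ < 13 / 10 * a →
      ∃ k i j : ℤ, ((k = 0 ∧ -1 ≤ i ∧ i ≤ 0 ∧ -1 ≤ j ∧ j ≤ 1 ∧ -1 ≤ i + j ∧ i + j ≤ 0) ∨
        ((k = 1 ∨ k = -1) ∧ i = -1 ∧ j = 0)) ∧ A x = barlowPos a h alternatingHagg k i j) : False := by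
  set p := barlowPos a h alternatingHagg 1 0 0 with hpdef
  -- distances to `p` of the four neighbours `u, v, p - u, p - v`
  have near : ∀ k i j : ℤ, ((1 - k = 0 ∧ -1 ≤ -i ∧ -i ≤ 1 ∧ -1 ≤ -j ∧ -j ≤ 1 ∧
        -1 ≤ -i + -j ∧ -i + -j ≤ 1) ∨ ((1 - k = 1 ∨ 1 - k = -1) ∧ -1 ≤ -i ∧ -i ≤ 0 ∧
        -1 ≤ -j ∧ -j ≤ 0 ∧ -1 ≤ -i + -j)) →
      ‖barlowPos a h alternatingHagg k i j - p‖ < 13 / 10 * a := by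
    intro k i j hidx
    rw [← norm_neg, neg_sub, hpdef, site_sub_of_odd odd_one]
    exact (norm_site_lt_iff ha hh1 hh2 _ _ _).2 (by omega)
  -- the images
  have img : ∀ k i j : ℤ,
      ((k = 0 ∧ -1 ≤ i ∧ i ≤ 1 ∧ -1 ≤ j ∧ j ≤ 1 ∧ -1 ≤ i + j ∧ i + j ≤ 1) ∨
        ((k = 1 ∨ k = -1) ∧ -1 ≤ i ∧ i ≤ 0 ∧ -1 ≤ j ∧ j ≤ 0 ∧ -1 ≤ i + j)) →
      ((1 - k = 0 ∧ -1 ≤ -i ∧ -i ≤ 1 ∧ -1 ≤ -j ∧ -j ≤ 1 ∧ -1 ≤ -i + -j ∧ -i + -j ≤ 1) ∨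
        ((1 - k = 1 ∨ 1 - k = -1) ∧ -1 ≤ -i ∧ -i ≤ 0 ∧ -1 ≤ -j ∧ -j ≤ 0 ∧ -1 ≤ -i + -j)) →
      ¬ (k = 0 ∧ i = 0 ∧ j = 0) → ¬ (k = 1 ∧ i = 0 ∧ j = 0) →
      ∃ k' i' j' : ℤ, (((k' = 0 ∧ -1 ≤ i' ∧ i' ≤ 0 ∧ -1 ≤ j' ∧ j' ≤ 1 ∧ -1 ≤ i' + j' ∧
        i' + j' ≤ 0) ∨ ((k' = 1 ∨ k' = -1) ∧ i' = -1 ∧ j' = 0)) ∧ ¬ (k' = 0 ∧ i' = 0 ∧ j' = 0) ∧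
        ¬ (k' = 0 ∧ i' = -1 ∧ j' = 0)) ∧
        A (barlowPos a h alternatingHagg k i j) = barlowPos a h alternatingHagg k' i' j' := by
    intro k i j hL hnear h0 hp1
    obtain ⟨k', i', j', hK', he⟩ := hwin _ (site_mem_cluster ha hh1 hh2 hL) (near k i j hnear)
    refine ⟨k', i', j', ⟨hK', ?_, ?_⟩, he⟩
    · rintro ⟨rfl, rfl, rfl⟩
      rw [barlowPos_alternating_zero, LinearIsometryEquiv.map_eq_zero_iff,
        ← barlowPos_alternating_zero a h] at he
      have := site_inj ha.ne' hh.ne' he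
      exact h0 ⟨this.1, this.2.1, this.2.2⟩
    · rintro ⟨rfl, rfl, rfl⟩
      have hu' : barlowPos a h alternatingHagg 0 (-1) 0 = -barlowPos a h alternatingHagg 0 1 0 := by
        rw [neg_site_zero]; norm_num
      rw [hu', ← hAp, hpdef] at he
      have := site_inj ha.ne' hh.ne' (A.injective he)
      omega
  obtain ⟨k₁, i₁, j₁, ⟨hK₁, h0₁, hu₁⟩, e₁⟩ := img 0 1 0 (by omega) (by omega) (by omega) (by omega)
  obtain ⟨k₂, i₂, j₂, ⟨hK₂, h0₂, hu₂⟩, e₂⟩ := img 0 0 1 (by omega) (by omega) (by omega) (by omega)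
  obtain ⟨k₃, i₃, j₃, ⟨hK₃, h0₃, hu₃⟩, e₃⟩ := img 1 (-1) 0 (by omega) (by omega) (by omega) (by omega)
  obtain ⟨k₄, i₄, j₄, ⟨hK₄, h0₄, hu₄⟩, e₄⟩ := img 1 0 (-1) (by omega) (by omega) (by omega) (by omega)
  have hL0 : haggLabel alternatingHagg 0 = 0 := haggLabel_zero _
  have hL1 : haggLabel alternatingHagg 1 = 1 := haggLabel_alternating_of_odd odd_one
  have d12 : dist (barlowPos a h alternatingHagg k₁ i₁ j₁) (barlowPos a h alternatingHagg k₂ i₂ j₂) ^ 2 =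
      a ^ 2 := by
    rw [← e₁, ← e₂, A.dist_map, dist_sq_sites (a := a) (h := h) _ _ _ _ _ _ _ _ hL0 hL0]
    push_cast; ring
  have d34 : dist (barlowPos a h alternatingHagg k₃ i₃ j₃) (barlowPos a h alternatingHagg k₄ i₄ j₄) ^ 2 =
      a ^ 2 := by
    rw [← e₃, ← e₄, A.dist_map, dist_sq_sites (a := a) (h := h) _ _ _ _ _ _ _ _ hL1 hL1]
    push_cast; ring
  have c12 := window_pair_dist_eq ha hh1 hh2 hK₁ h0₁ hu₁ hK₂ h0₂ hu₂ d12
  have c34 := window_pair_dist_eq ha hh1 hh2 hK₃ h0₃ hu₃ hK₄ h0₄ hu₄ d34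
  -- two distinct preimages of `v - u`
  have key : ∀ {x y : EuclideanSpace ℝ (Fin 3)}, A x = barlowPos a h alternatingHagg 0 (-1) 1 →
      A y = barlowPos a h alternatingHagg 0 (-1) 1 → x = y := fun hx hy =>
    A.injective (hx.trans hy.symm)
  rcases c12 with ⟨rfl, rfl, rfl⟩ | ⟨rfl, rfl, rfl⟩ <;> rcases c34 with ⟨rfl, rfl, rfl⟩ | ⟨rfl, rfl, rfl⟩
  · have := site_inj ha.ne' hh.ne' (key e₁ e₃); omega
  · have := site_inj ha.ne' hh.ne' (key e₁ e₄); omega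
  · have := site_inj ha.ne' hh.ne' (key e₂ e₃); omega
  · have := site_inj ha.ne' hh.ne' (key e₂ e₄); omega

/-- **The bond preimage in the hexagon: `A` fixes `−v`.** After normalising so that `A u = u`
(hence `A (−u) = −u`) with all cluster sites near `−u` mapped to window sites, `A (−v) = −v`:
the image of `−v` is a window site other than `0, −u`; if it were `v − u` then the image of
`w − u + h e₃` would be a window site at squared distance `4a²/3 + h²` from `v − u` (none exists);
if it were `w − u ± h e₃` then the image of `v − u` would be a window site at squared distance
`3a²` from it (none exists). [folklore] -/
theorem bond_fix_neg_v (ha : 0 < a) (hh : 0 < h) (hh1 : 64 / 100 * a ^ 2 < h ^ 2)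
    (hh2 : h ^ 2 < 69 / 100 * a ^ 2)
    (A : EuclideanSpace ℝ (Fin 3) ≃ₗᵢ[ℝ] EuclideanSpace ℝ (Fin 3))
    (hAu : A (barlowPos a h alternatingHagg 0 1 0) = barlowPos a h alternatingHagg 0 1 0)
    (hwin : ∀ x ∈ {p : EuclideanSpace ℝ (Fin 3) | p ∈ hcpStacking a h ∧ ‖p‖ < 13 / 10 * a},
      ‖x + barlowPos a h alternatingHagg 0 1 0‖ < 13 / 10 * a →
      ∃ k i j : ℤ, ((k = 0 ∧ -1 ≤ i ∧ i ≤ 0 ∧ -1 ≤ j ∧ j ≤ 1 ∧ -1 ≤ i + j ∧ i + j ≤ 0) ∨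
        ((k = 1 ∨ k = -1) ∧ i = -1 ∧ j = 0)) ∧ A x = barlowPos a h alternatingHagg k i j) :
    A (barlowPos a h alternatingHagg 0 0 (-1)) = barlowPos a h alternatingHagg 0 0 (-1) := by
  set u := barlowPos a h alternatingHagg 0 1 0 with hudef
  have hL0 : haggLabel alternatingHagg 0 = 0 := haggLabel_zero _
  have hL1 : haggLabel alternatingHagg 1 = 1 := haggLabel_alternating_of_odd odd_one
  have hLm : haggLabel alternatingHagg (-1) = 1 := haggLabel_alternating_of_odd (by decide)
  -- images of sites `x` with `x + u` a cluster site
  have img : ∀ k i j : ℤ,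
      ((k = 0 ∧ -1 ≤ i ∧ i ≤ 1 ∧ -1 ≤ j ∧ j ≤ 1 ∧ -1 ≤ i + j ∧ i + j ≤ 1) ∨
        ((k = 1 ∨ k = -1) ∧ -1 ≤ i ∧ i ≤ 0 ∧ -1 ≤ j ∧ j ≤ 0 ∧ -1 ≤ i + j)) →
      ((k = 0 ∧ -1 ≤ i + 1 ∧ i + 1 ≤ 1 ∧ -1 ≤ j ∧ j ≤ 1 ∧ -1 ≤ i + 1 + j ∧ i + 1 + j ≤ 1) ∨
        ((k = 1 ∨ k = -1) ∧ -1 ≤ i + 1 ∧ i + 1 ≤ 0 ∧ -1 ≤ j ∧ j ≤ 0 ∧ -1 ≤ i + 1 + j)) →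
      ∃ k' i' j' : ℤ, ((k' = 0 ∧ -1 ≤ i' ∧ i' ≤ 0 ∧ -1 ≤ j' ∧ j' ≤ 1 ∧ -1 ≤ i' + j' ∧
        i' + j' ≤ 0) ∨ ((k' = 1 ∨ k' = -1) ∧ i' = -1 ∧ j' = 0)) ∧
        A (barlowPos a h alternatingHagg k i j) = barlowPos a h alternatingHagg k' i' j' := by
    intro k i j hL hLu
    refine hwin _ (site_mem_cluster ha hh1 hh2 hL) ?_
    rw [hudef, add_comm, hcp_add_of_even a h Even.zero, zero_add, zero_add, add_comm 1 i]
    exact (norm_site_lt_iff ha hh1 hh2 k (i + 1) j).2 hLu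
  obtain ⟨k₀, i₀, j₀, hK₀, e₀⟩ := img 0 0 (-1) (by omega) (by omega)
  -- not `0`, not `-u`
  have h00 : ¬ (k₀ = 0 ∧ i₀ = 0 ∧ j₀ = 0) := by
    rintro ⟨rfl, rfl, rfl⟩
    rw [barlowPos_alternating_zero, LinearIsometryEquiv.map_eq_zero_iff,
      ← barlowPos_alternating_zero a h] at e₀
    have := site_inj ha.ne' hh.ne' e₀
    omega
  have h0u : ¬ (k₀ = 0 ∧ i₀ = -1 ∧ j₀ = 0) := by
    rintro ⟨rfl, rfl, rfl⟩
    have hu' : barlowPos a h alternatingHagg 0 (-1) 0 = A (barlowPos a h alternatingHagg 0 (-1) 0) := by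
      have e1 : barlowPos a h alternatingHagg 0 (-1) 0 = -u := by
        rw [hudef, neg_site_zero]; norm_num
      rw [e1, map_neg, hAu]
    rw [hu'] at e₀
    have := site_inj ha.ne' hh.ne' (A.injective e₀)
    omega
  have hfour : (k₀ = 0 ∧ i₀ = 0 ∧ j₀ = -1) ∨ (k₀ = 0 ∧ i₀ = -1 ∧ j₀ = 1) ∨
      (k₀ = 1 ∧ i₀ = -1 ∧ j₀ = 0) ∨ (k₀ = -1 ∧ i₀ = -1 ∧ j₀ = 0) := by omega
  rcases hfour with ⟨rfl, rfl, rfl⟩ | ⟨rfl, rfl, rfl⟩ | ⟨rfl, rfl, rfl⟩ | ⟨rfl, rfl, rfl⟩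
  · exact e₀
  · -- image `v - u`: look at the image of the cap `w - u + e = 𝔰 1 (-1) 0`
    exfalso
    obtain ⟨k₁, i₁, j₁, hK₁, e₁⟩ := img 1 (-1) 0 (by omega) (by omega)
    have hd : dist (barlowPos a h alternatingHagg k₁ i₁ j₁) (barlowPos a h alternatingHagg 0 (-1) 1) ^ 2 =
        4 * a ^ 2 / 3 + h ^ 2 := by
      rw [← e₁, ← e₀, A.dist_map, dist_sq_sites (a := a) (h := h) _ _ _ _ _ _ _ _ hL1 hL0]
      push_cast; ring
    exact window_dist_ne_one ha hh1 hh2 hK₁ hd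
  · -- image `w - u + e`: look at the image of `v - u = 𝔰 0 (-1) 1`
    exfalso
    obtain ⟨k₁, i₁, j₁, hK₁, e₁⟩ := img 0 (-1) 1 (by omega) (by omega)
    have hd : dist (barlowPos a h alternatingHagg k₁ i₁ j₁) (barlowPos a h alternatingHagg 1 (-1) 0) ^ 2 =
        3 * a ^ 2 := by
      rw [← e₁, ← e₀, A.dist_map, dist_sq_sites (a := a) (h := h) _ _ _ _ _ _ _ _ hL0 hL0]
      push_cast; ring
    exact window_dist_ne_two ha hh1 hh2 hK₁ hd
  · -- image `w - u - e`: the same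
    exfalso
    obtain ⟨k₁, i₁, j₁, hK₁, e₁⟩ := img 0 (-1) 1 (by omega) (by omega)
    have hd : dist (barlowPos a h alternatingHagg k₁ i₁ j₁) (barlowPos a h alternatingHagg (-1) (-1) 0) ^ 2 =
        3 * a ^ 2 := by
      rw [← e₁, ← e₀, A.dist_map, dist_sq_sites (a := a) (h := h) _ _ _ _ _ _ _ _ hL0 hL0]
      push_cast; ring
    exact window_dist_ne_three ha hh1 hh2 hK₁ hd

/-- **Bond rigidity along the in-layer bond `u`.** Let `A` be a linear isometry such that, on
the ball `‖x‖ < 13/10 a`, the image cluster `A '' N` near `−u` agrees with the translate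
`N − u` (precisely: `x ∈ A '' N ∧ ‖u + x‖ < 13/10 a ↔ u + x ∈ N ∧ ‖x‖ < 13/10 a`).  Then
`A '' N = N`.  Proof: `q := A⁻¹(−u)` is a cluster site; it is not a cap site (`bond_not_cap`
after moving `q` to `w + h e₃` by a symmetry of the cluster), so it is a hexagon site; moving
`−q` to `u` by a symmetry, `A` fixes `u` and then `−v` (`bond_fix_neg_v`), hence `v`, so
`A ∈ {1, σ_h}` fixes the cluster. [folklore] -/
theorem image_cluster_eq_of_bond (ha : 0 < a) (hh : 0 < h) (hh1 : 64 / 100 * a ^ 2 < h ^ 2)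
    (hh2 : h ^ 2 < 69 / 100 * a ^ 2)
    (A : EuclideanSpace ℝ (Fin 3) ≃ₗᵢ[ℝ] EuclideanSpace ℝ (Fin 3))
    (hK : ∀ x : EuclideanSpace ℝ (Fin 3),
      (x ∈ A '' {p : EuclideanSpace ℝ (Fin 3) | p ∈ hcpStacking a h ∧ ‖p‖ < 13 / 10 * a} ∧
          ‖barlowPos a h alternatingHagg 0 1 0 + x‖ < 13 / 10 * a) ↔
        (barlowPos a h alternatingHagg 0 1 0 + x ∈
            {p : EuclideanSpace ℝ (Fin 3) | p ∈ hcpStacking a h ∧ ‖p‖ < 13 / 10 * a} ∧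
          ‖x‖ < 13 / 10 * a)) :
    A '' {p : EuclideanSpace ℝ (Fin 3) | p ∈ hcpStacking a h ∧ ‖p‖ < 13 / 10 * a} =
      {p : EuclideanSpace ℝ (Fin 3) | p ∈ hcpStacking a h ∧ ‖p‖ < 13 / 10 * a} := by
  set N := {p : EuclideanSpace ℝ (Fin 3) | p ∈ hcpStacking a h ∧ ‖p‖ < 13 / 10 * a} with hN
  set u := barlowPos a h alternatingHagg 0 1 0 with hudef
  have hL0 : haggLabel alternatingHagg 0 = 0 := haggLabel_zero _
  -- `q := A⁻¹ (-u)` is a nonzero cluster site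
  have hnegu : -u ∈ A '' N := by
    refine ((hK (-u)).2 ⟨?_, ?_⟩).1
    · rw [add_neg_cancel]
      exact ⟨⟨0, 0, 0, (barlowPos_alternating_zero a h).symm⟩, by simp; positivity⟩
    · rw [norm_neg, norm_lt_iff_sq_lt (by positivity), hudef, norm_sq_u]; nlinarith
  obtain ⟨⟨k, i, j, hq⟩, hqn⟩ := mem_image_equiv_iff.1 hnegu
  set q := A.symm (-u) with hqdef
  rw [hq] at hqn
  have hidx := (norm_site_lt_iff ha hh1 hh2 k i j).1 hqn
  have hAq : A (barlowPos a h alternatingHagg k i j) = -u := by rw [← hq, A.apply_symm_apply]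
  have hq0 : ¬ (i = 0 ∧ j = 0 ∧ k = 0) := by
    rintro ⟨rfl, rfl, rfl⟩
    rw [barlowPos_alternating_zero, map_zero, eq_comm, neg_eq_zero] at hAq
    have := congrArg (fun x : EuclideanSpace ℝ (Fin 3) => x 0) hAq
    simp [hudef, hL0] at this
    exact ha.ne' this
  -- the window, transported along a symmetry `g` of the cluster
  have win : ∀ g : EuclideanSpace ℝ (Fin 3) ≃ₗᵢ[ℝ] EuclideanSpace ℝ (Fin 3),
      (∀ x, g x ∈ hcpStacking a h ↔ x ∈ hcpStacking a h) →
      ∀ x ∈ N, ‖x - g.symm q‖ < 13 / 10 * a →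
      ∃ k i j : ℤ, ((k = 0 ∧ -1 ≤ i ∧ i ≤ 0 ∧ -1 ≤ j ∧ j ≤ 1 ∧ -1 ≤ i + j ∧ i + j ≤ 0) ∨
        ((k = 1 ∨ k = -1) ∧ i = -1 ∧ j = 0)) ∧
        (g.trans A) x = barlowPos a h alternatingHagg k i j := by
    intro g hg x hx hxq
    have hgx : g x ∈ N := ⟨(hg x).2 hx.1, by rw [g.norm_map]; exact hx.2⟩
    have hd : ‖g x - A.symm (-u)‖ < 13 / 10 * a := by
      rw [← hqdef]
      have : g x - q = g (x - g.symm q) := by rw [map_sub, g.apply_symm_apply]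
      rw [this, g.norm_map]; exact hxq
    exact window_of_bond ha hh1 hh2 A hK hgx hd
  rcases hidx with ⟨rfl, hij⟩ | ⟨hk, hij⟩
  · -- hexagon case: normalise `-q ↦ u`
    have hij' : -1 ≤ -i ∧ -i ≤ 1 ∧ -1 ≤ -j ∧ -j ≤ 1 ∧ -1 ≤ -i + -j ∧ -i + -j ≤ 1 := by omega
    obtain ⟨g, hg, hgu⟩ := exists_sym_apply_u (h := h) ha.ne' hij' (by omega)
    set A₁ := g.trans A with hA₁
    have hA₁u : A₁ u = u := by
      have h1 : A₁ (-u) = -u := by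
        rw [hA₁, LinearIsometryEquiv.trans_apply, map_neg, hudef, hgu, neg_site_zero]
        simpa using hAq
      rw [map_neg, neg_inj] at h1
      exact h1
    have hgsymm : g.symm q = -u := by
      apply g.injective
      rw [g.apply_symm_apply, hq, map_neg, hudef, hgu, neg_site_zero]; simp
    have hwin : ∀ x ∈ N, ‖x + u‖ < 13 / 10 * a →
        ∃ k i j : ℤ, ((k = 0 ∧ -1 ≤ i ∧ i ≤ 0 ∧ -1 ≤ j ∧ j ≤ 1 ∧ -1 ≤ i + j ∧ i + j ≤ 0) ∨
          ((k = 1 ∨ k = -1) ∧ i = -1 ∧ j = 0)) ∧ A₁ x = barlowPos a h alternatingHagg k i j := by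
      intro x hx hxu
      refine win g hg x hx ?_
      rw [hgsymm, sub_neg_eq_add]; exact hxu
    have hA₁v : A₁ (barlowPos a h alternatingHagg 0 0 1) = barlowPos a h alternatingHagg 0 0 1 := by
      have h1 := bond_fix_neg_v ha hh hh1 hh2 A₁ hA₁u hwin
      have hv' : barlowPos a h alternatingHagg 0 0 (-1) = -barlowPos a h alternatingHagg 0 0 1 := by
        rw [neg_site_zero]; norm_num
      rw [hv', map_neg, neg_inj] at h1
      exact h1
    have hA₁N : A₁ '' N = A '' N := by
      have : (A₁ : EuclideanSpace ℝ (Fin 3) → EuclideanSpace ℝ (Fin 3)) = A ∘ g := rfl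
      rw [this, Set.image_comp, image_cluster_eq_of_mem_iff hg]
    rw [← hA₁N]
    rcases eq_refl_or_mirrorH ha.ne' hh.ne' A₁ hA₁u hA₁v with h1 | h1
    · have : A₁ = LinearIsometryEquiv.refl ℝ _ := LinearIsometryEquiv.ext h1
      rw [this]; simp
    · have : A₁ = (ℝ ∙ layerNormal h)ᗮ.reflection := LinearIsometryEquiv.ext h1
      rw [this]
      exact image_cluster_eq_of_mem_iff (mirrorH_mem_iff hh.ne') _
  · -- cap case: impossible
    exfalso
    obtain ⟨g, hg, hgp⟩ := exists_sym_apply_cap (a := a) (h := h) ha.ne' hh.ne' hk hij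
    set A₁ := g.trans A with hA₁
    have hA₁p : A₁ (barlowPos a h alternatingHagg 1 0 0) = -u := by
      rw [hA₁, LinearIsometryEquiv.trans_apply, hgp]; exact hAq
    have hgsymm : g.symm q = barlowPos a h alternatingHagg 1 0 0 := by
      apply g.injective
      rw [g.apply_symm_apply, hq, hgp]
    have hwin : ∀ x ∈ N, ‖x - barlowPos a h alternatingHagg 1 0 0‖ < 13 / 10 * a →
        ∃ k i j : ℤ, ((k = 0 ∧ -1 ≤ i ∧ i ≤ 0 ∧ -1 ≤ j ∧ j ≤ 1 ∧ -1 ≤ i + j ∧ i + j ≤ 0) ∨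
          ((k = 1 ∨ k = -1) ∧ i = -1 ∧ j = 0)) ∧ A₁ x = barlowPos a h alternatingHagg k i j := by
      intro x hx hxp
      refine win g hg x hx ?_
      rw [hgsymm]; exact hxp
    exact bond_not_cap ha hh hh1 hh2 A₁ hA₁p hwin

end Bond

end Summit.AtomisticToContinuum.Crystallization.Theorems.ExactHcpLocal

end
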